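import Mathlib
import HarnessLib
import Summits.PneNP.PneNP.Theorems.CnfIdealGenLengthRankDefectRepresentationsGoodBlocks

/-!
# Absolute merge when one system has RANK-ONE cells (crux `RankDefectRepresentations` = stmt-PneNP-18923,
# line `cell-union-merge`; lead g18)

The lead stub `stub_absoluteMerge` (AMB) of `Lines/cell_union_merge.lean` at the extreme OPPOSITE to its landed `|X| = 2`
shadow (W26, p727869): here `P` has as many cells as the dimension, each of rank one (`|X| = d`), and `Q` is arbitrary.
THEOREM (`absoluteMerge_rankOne`): if every `P_x` has rank one and `rank [P_A, Q_B] ≤ c` for all unions, then there is a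
complete orthogonal system `Q'` COMMUTING WITH `P` (so `P' = P`) with `rank (Q_B − Q'_B) ≤ 384 c` for every union `B`.

Proof (memo `Lines/cell-union-merge-g18.md` §4(c), made deterministic): the family cut lemma (`…FamilyCutLemma`, p734569)
writes `Q_y = G_y + U α_y + β_y W` with `G_y ∈ Comm(P)` and `r ≤ 32c`; `goodBlocks` (`…GoodBlocks`) leaves at most `8r` lines
`x` where the scalars `P_x G_y P_x = g_y(x) P_x` fail to be orthogonal idempotents, and at most `rank (1 − G_Y) ≤ 2r` further
lines where they fail to sum to one; every other line is OWNED by exactly one `y` (`g_y(x) = 1`).  `Q'_y :=` the sum of the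
lines owned by `y` (orphans go to a fixed `y₀`) is exact, commutes with `P`, and `Q_B − Q'_B = N_B + ∑_{x exceptional} P_x(…)`
has rank `≤ 2r + 10r ≤ 384c`.
HONEST FRAMING: a special case of AMB in the negative lane; AMB/BE for general `P` stay open; P ≠ NP is not moved; F-N2 is a
FRONTIER formal rung.
-/

set_option linter.dupNamespace false -- `Summit.PneNP.PneNP.…`: summit = sub-problem name (D-0017)

namespace Summit.PneNP.PneNP.Theorems.CnfIdealGenLengthRankDefectRepresentationsRankOneCells

open Matrix Module
open Summit.PneNP.PneNP.Theorems.CnfIdealGenLengthRankDefectRepresentationsFamilyCutLemma (familyCutLemma rank_mul_le_inner)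
open Summit.PneNP.PneNP.Theorems.CnfIdealGenLengthRankDefectRepresentationsGoodBlocks (goodBlocks)
open Summit.PneNP.PneNP.Theorems.CnfIdealGenLengthRankDefectRepresentationsMergeLowerBound (rank_add_le' rank_sub_le')
open Summit.PneNP.PneNP.Theorems.CnfIdealGenLengthRankDefectRepresentationsCutLemmaMaxCut (rank_finsetSum_le)

variable {K : Type} [Field K] {d : ℕ}

/-! ## Rank-one idempotents act by scalars on their line -/

section RankOne

/-- A rank-one matrix is an outer product `v wᵀ`. [folklore] -/
theorem exists_vecMulVec_of_rank_one (P : Matrix (Fin d) (Fin d) K) (hP : P.rank = 1) :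
    ∃ v w : Fin d → K, P = Matrix.vecMulVec v w := by
  obtain ⟨r, A, B, hr, hAB⟩ :=
    Summit.PneNP.PneNP.Theorems.CnfIdealGenLengthRankDefectRepresentationsFamilyCutLemma.exists_factor P
  rw [hP] at hr
  subst hr
  refine ⟨fun i => A i 0, fun j => B 0 j, ?_⟩
  rw [hAB]
  ext i j
  rw [Matrix.mul_apply, Matrix.vecMulVec_apply, Fin.sum_univ_one]

/-- For a rank-one `P` and any `M`: `P M P = t • P` for a scalar `t`. [folklore] -/
theorem exists_smul_of_rank_one (P M : Matrix (Fin d) (Fin d) K) (hP : P.rank = 1) : ∃ t : K, P * M * P = t • P := by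
  obtain ⟨v, w, hvw⟩ := exists_vecMulVec_of_rank_one P hP
  refine ⟨w ⬝ᵥ (M *ᵥ v), ?_⟩
  rw [hvw]
  ext i j
  simp only [Matrix.mul_apply, Matrix.vecMulVec_apply, Matrix.smul_apply, smul_eq_mul, dotProduct, Matrix.mulVec,
    Finset.sum_mul, Finset.mul_sum]
  rw [Finset.sum_comm]
  refine Finset.sum_congr rfl fun k _ => Finset.sum_congr rfl fun l _ => by ring

end RankOne

/-! ## The theorem -/

section Main

variable [CharZero K] {X Y : Type} [Fintype X] [Fintype Y] [DecidableEq X] [DecidableEq Y]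

/-- **AMB for rank-one cells, `P' = P`.**  If every cell of `P` has rank one and all cross commutators of unions have rank
`≤ c`, then `Q` is union-wise within rank `384 c` of a complete orthogonal system commuting with every `P_x`. -/
theorem absoluteMerge_rankOne (P : X → Matrix (Fin d) (Fin d) K) (Q : Y → Matrix (Fin d) (Fin d) K) (c : ℕ)
    (hP1 : ∀ x, (P x).rank = 1)
    (hPi : ∀ x, P x * P x = P x) (hPo : ∀ x x', x ≠ x' → P x * P x' = 0) (hPs : ∑ x, P x = 1)
    (hQi : ∀ y, Q y * Q y = Q y) (hQo : ∀ y y', y ≠ y' → Q y * Q y' = 0) (hQs : ∑ y, Q y = 1)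
    (hc : ∀ (A : Finset X) (B : Finset Y),
      ((∑ x ∈ A, P x) * (∑ y ∈ B, Q y) - (∑ y ∈ B, Q y) * (∑ x ∈ A, P x)).rank ≤ c) :
    ∃ Q' : Y → Matrix (Fin d) (Fin d) K,
      (∀ y, Q' y * Q' y = Q' y) ∧ (∀ y y', y ≠ y' → Q' y * Q' y' = 0) ∧ ∑ y, Q' y = 1 ∧
      (∀ x y, P x * Q' y = Q' y * P x) ∧
      ∀ B : Finset Y, ((∑ y ∈ B, Q y) - ∑ y ∈ B, Q' y).rank ≤ 384 * c := by
  classical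
  -- family cut lemma and good blocks
  obtain ⟨r, U, W, hr, key⟩ := familyCutLemma P Q c hPi hPo hPs hQi hQo hQs hc
  choose G α β hGP hQ using key
  obtain ⟨S, hS, hgood⟩ := goodBlocks P Q G r U W α β hPi hPo hQi hQo (fun x y => hGP y x) hQ
  -- scalars: `P_x G_y = P_x G_y P_x = g y x • P_x`
  have hPG : ∀ x y, P x * G y = P x * G y * P x := by
    intro x y; rw [Matrix.mul_assoc, hGP y x, ← Matrix.mul_assoc, hPi]
  have hg : ∀ x y, ∃ t : K, P x * G y = t • P x := by
    intro x y
    obtain ⟨t, ht⟩ := exists_smul_of_rank_one (P x) (G y) (hP1 x)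
    exact ⟨t, by rw [hPG, ht]⟩
  choose g hg using hg
  have hPne : ∀ x, P x ≠ 0 := fun x h => by have := hP1 x; rw [h, Matrix.rank_zero] at this; exact zero_ne_one this
  -- on good lines the scalars are 0/1 and at most one is nonzero
  have hg01 : ∀ x ∉ S, ∀ y, g x y = 0 ∨ g x y = 1 := by
    intro x hx y
    have h := (hgood x hx).1 y
    rw [hg, Matrix.smul_mul, Matrix.mul_smul, hPi, smul_smul] at h
    have h' : (g x y * g x y - g x y) • P x = 0 := by rw [sub_smul, h, sub_self]
    rcases smul_eq_zero.mp h' with h'' | h''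
    · rcases mul_eq_zero.mp (by rw [mul_sub, mul_one]; exact h'' : g x y * (g x y - 1) = 0) with h3 | h3
      · exact Or.inl h3
      · exact Or.inr (sub_eq_zero.mp h3)
    · exact absurd h'' (hPne x)
  have hgorth : ∀ x ∉ S, ∀ y y', y ≠ y' → g x y = 0 ∨ g x y' = 0 := by
    intro x hx y y' hyy'
    have h := (hgood x hx).2 y y' hyy'
    rw [hg, hg, Matrix.smul_mul, Matrix.mul_smul, hPi, smul_smul] at h
    rcases smul_eq_zero.mp h with h'' | h''
    · exact (mul_eq_zero.mp h'').imp id id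
    · exact absurd h'' (hPne x)
  -- lines where the scalars do not sum to one: at most `rank (1 − G_Y)` many; together with `S`, the exceptional set `T`
  let T : Finset X := S ∪ Finset.univ.filter fun x => P x * (∑ y, G y) ≠ P x
  -- owner of a non-exceptional line
  have hown : ∀ x ∉ T, ∃! y, g x y = 1 := by
    intro x hx
    have hxS : x ∉ S := fun h => hx (Finset.mem_union_left _ h)
    have hsum : P x * (∑ y, G y) = P x := by
      by_contra h
      exact hx (Finset.mem_union_right _ (Finset.mem_filter.mpr ⟨Finset.mem_univ x, h⟩))
    rw [Finset.mul_sum] at hsum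
    simp_rw [hg] at hsum
    rw [← Finset.sum_smul] at hsum
    have h1 : ∑ y, g x y = 1 := by
      by_contra hne
      have : (∑ y, g x y - 1) • P x = 0 := by rw [sub_smul, hsum, one_smul, sub_self]
      rcases smul_eq_zero.mp this with h | h
      · exact hne (sub_eq_zero.mp h)
      · exact hPne x h
    -- some scalar is nonzero, hence 1, and it is unique
    have hex : ∃ y, g x y = 1 := by
      by_contra hnone
      have : ∀ y, g x y = 0 := fun y => (hg01 x hxS y).resolve_right fun h => hnone ⟨y, h⟩
      rw [Finset.sum_eq_zero (fun y _ => this y)] at h1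
      exact zero_ne_one h1
    obtain ⟨y₁, hy₁⟩ := hex
    refine ⟨y₁, hy₁, fun y hy => ?_⟩
    by_contra hne
    rcases hgorth x hxS y y₁ hne with h | h
    · rw [hy] at h; exact one_ne_zero h
    · rw [hy₁] at h; exact one_ne_zero h
  -- the owner map (exceptional lines get `none`)
  let owner : X → Option Y := fun x => if hx : x ∉ T then some (Classical.choose (hown x hx)) else none
  have howner_spec : ∀ x (hx : x ∉ T), owner x = some (Classical.choose (hown x hx)) := fun x hx => dif_pos hx
  have howner_T : ∀ x ∈ T, owner x = none := fun x hx => dif_neg (not_not.mpr hx)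
  have hg_owner : ∀ x (hx : x ∉ T) y, g x y = if owner x = some y then 1 else 0 := by
    intro x hx y
    rw [howner_spec x hx]
    have hspec := Classical.choose_spec (hown x hx)
    by_cases h : Classical.choose (hown x hx) = y
    · rw [if_pos (congrArg some h), ← h]; exact hspec.1
    · rw [if_neg (fun h' => h (Option.some_injective _ h'))]
      have hxS : x ∉ S := fun h' => hx (Finset.mem_union_left _ h')
      rcases hg01 x hxS y with h0 | h1
      · exact h0
      · exact absurd (hspec.2 y h1).symm h
  -- the new system: cells = lines owned (orphans to `y₀` if `Y` is nonempty)
  by_cases hY : Nonempty Y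
  swap
  · -- `Y` empty: then `1 = ∑ Q = 0`, so `d = 0`-like degenerate case; `Q' := Q` works trivially
    refine ⟨Q, hQi, hQo, hQs, fun x y => absurd ⟨y⟩ hY, fun B => ?_⟩
    rw [sub_self, Matrix.rank_zero]; exact Nat.zero_le _
  obtain ⟨y₀⟩ := hY
  let own : X → Y := fun x => (owner x).getD y₀
  let Q' : Y → Matrix (Fin d) (Fin d) K := fun y => ∑ x ∈ Finset.univ.filter (fun x => own x = y), P x
  have hQ'B : ∀ B : Finset Y, ∑ y ∈ B, Q' y = ∑ x ∈ Finset.univ.filter (fun x => own x ∈ B), P x := by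
    intro B
    show ∑ y ∈ B, ∑ x ∈ Finset.univ.filter (fun x => own x = y), P x = _
    rw [← Finset.sum_biUnion]
    · congr 1
      ext x
      simp only [Finset.mem_biUnion, Finset.mem_filter, Finset.mem_univ, true_and, exists_eq_right']
    · intro y _ y' _ hyy'
      simp only [Function.onFun]
      rw [Finset.disjoint_filter]
      intro x _ h h'
      exact hyy' (h.symm.trans h')
  -- sums of cells over a set of lines are idempotent, and products of disjoint ones vanish
  have hPsum_mul : ∀ (A A' : Finset X), (∑ x ∈ A, P x) * (∑ x ∈ A', P x) = ∑ x ∈ A ∩ A', P x := by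
    intro A A'
    rw [Finset.sum_mul_sum, ← Finset.sum_ite_mem]
    refine Finset.sum_congr rfl fun x _ => ?_
    by_cases h : x ∈ A'
    · rw [if_pos h, Finset.sum_eq_single x]
      · exact hPi x
      · intro x' _ hx'; exact hPo x x' (Ne.symm hx')
      · intro h'; exact absurd h h'
    · rw [if_neg h]
      refine Finset.sum_eq_zero fun x' hx' => hPo x x' ?_
      intro heq; subst heq; exact h hx'
  refine ⟨Q', fun y => ?_, fun y y' hyy' => ?_, ?_, fun x y => ?_, fun B => ?_⟩
  · show (∑ x ∈ _, P x) * (∑ x ∈ _, P x) = ∑ x ∈ _, P x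
    rw [hPsum_mul, Finset.inter_self]
  · show (∑ x ∈ _, P x) * (∑ x ∈ _, P x) = 0
    rw [hPsum_mul]
    refine Finset.sum_eq_zero fun x hx => ?_
    exfalso
    rw [Finset.mem_inter, Finset.mem_filter, Finset.mem_filter] at hx
    exact hyy' (hx.1.2.symm.trans hx.2.2)
  · have h := hQ'B Finset.univ
    rw [show (Finset.univ.filter fun x => own x ∈ (Finset.univ : Finset Y)) = Finset.univ from
      Finset.filter_true_of_mem fun x _ => Finset.mem_univ _] at h
    rw [h, hPs]
  · show P x * (∑ x' ∈ _, P x') = (∑ x' ∈ _, P x') * P x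
    rw [Finset.mul_sum, Finset.sum_mul]
    refine Finset.sum_congr rfl fun x' _ => ?_
    by_cases h : x = x'
    · subst h; rfl
    · rw [hPo x x' h, hPo x' x (Ne.symm h)]
  · -- the cost: `Q_B − Q'_B = N_B + ∑_x P_x (G_B − Q'_B)`, nonzero only on exceptional lines
    have hQB : ∑ y ∈ B, Q y = (∑ y ∈ B, G y) + (U * (∑ y ∈ B, α y) + (∑ y ∈ B, β y) * W) := by
      rw [Matrix.mul_sum, Matrix.sum_mul, ← Finset.sum_add_distrib, ← Finset.sum_add_distrib]
      exact Finset.sum_congr rfl fun y _ => by rw [hQ y, add_assoc]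
    have hN : (U * (∑ y ∈ B, α y) + (∑ y ∈ B, β y) * W).rank ≤ 2 * r :=
      (rank_add_le' _ _).trans (by
        have := rank_mul_le_inner U (∑ y ∈ B, α y); have := rank_mul_le_inner (∑ y ∈ B, β y) W; omega)
    -- `G_B − Q'_B = ∑_x P_x (G_B − Q'_B)` and the good terms vanish
    set D := (∑ y ∈ B, G y) - ∑ y ∈ B, Q' y with hD
    have hDsplit : D = ∑ x, P x * D := by rw [← Finset.sum_mul, hPs, Matrix.one_mul]
    have hPxQ' : ∀ x, P x * (∑ y ∈ B, Q' y) = if own x ∈ B then P x else 0 := by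
      intro x
      rw [hQ'B, Finset.mul_sum]
      by_cases h : own x ∈ B
      · rw [if_pos h, Finset.sum_eq_single x]
        · exact hPi x
        · intro x' _ hx'; exact hPo x x' (Ne.symm hx')
        · intro hx; exact absurd (Finset.mem_filter.mpr ⟨Finset.mem_univ x, h⟩) hx
      · rw [if_neg h]
        refine Finset.sum_eq_zero fun x' hx' => hPo x x' ?_
        intro heq; subst heq; exact h (Finset.mem_filter.mp hx').2
    have hPxG : ∀ x, P x * (∑ y ∈ B, G y) = (∑ y ∈ B, g x y) • P x := by
      intro x
      rw [Finset.mul_sum, Finset.sum_smul]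
      exact Finset.sum_congr rfl fun y _ => hg x y
    have hgoodD : ∀ x ∉ T, P x * D = 0 := by
      intro x hx
      rw [hD, Matrix.mul_sub, hPxQ', hPxG]
      have hox : owner x = some (own x) := by
        show owner x = some ((owner x).getD y₀)
        rw [howner_spec x hx]; rfl
      have hsum : ∑ y ∈ B, g x y = if own x ∈ B then 1 else 0 := by
        have : ∀ y, g x y = if own x = y then 1 else 0 := by
          intro y
          rw [hg_owner x hx, hox]
          by_cases h : own x = y
          · rw [if_pos (congrArg some h), if_pos h]
          · rw [if_neg (fun h' => h (Option.some_injective _ h')), if_neg h]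
        simp_rw [this]
        exact Finset.sum_ite_eq B (own x) (fun _ => (1 : K))
      rw [hsum]
      split_ifs <;> simp
    -- `#T ≤ 8r + 2r`
    have hTcard : T.card ≤ 10 * r := by
      have hGY : ∀ x, (1 - ∑ y, G y) * P x = P x * (1 - ∑ y, G y) := by
        intro x
        rw [Matrix.sub_mul, Matrix.mul_sub, Matrix.one_mul, Matrix.mul_one, Finset.sum_mul, Finset.mul_sum]
        congr 1
        exact Finset.sum_congr rfl fun y _ => hGP y x
      obtain ⟨T₁, hT₁card, hT₁⟩ :=
        Summit.PneNP.PneNP.Theorems.CnfIdealGenLengthRankDefectRepresentationsGoodBlocks.card_filter_mul_ne_zero_le_rank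
          P (1 - ∑ y, G y) hPi hPo hGY
      have hNY : (1 - ∑ y, G y).rank ≤ 2 * r := by
        have h1 : (1 : Matrix (Fin d) (Fin d) K) - ∑ y, G y = U * (∑ y, α y) + (∑ y, β y) * W := by
          have := hQs
          rw [show (∑ y, Q y) = ∑ y ∈ Finset.univ, Q y from rfl] at this
          have hQB : ∑ y, Q y = (∑ y, G y) + (U * (∑ y, α y) + (∑ y, β y) * W) := by
            rw [Matrix.mul_sum, Matrix.sum_mul, ← Finset.sum_add_distrib, ← Finset.sum_add_distrib]
            exact Finset.sum_congr rfl fun y _ => by rw [hQ y, add_assoc]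
          rw [← hQs, hQB]; abel
        rw [h1]
        refine (rank_add_le' _ _).trans ?_
        have := rank_mul_le_inner U (∑ y, α y); have := rank_mul_le_inner (∑ y, β y) W; omega
      have hsub : T ⊆ S ∪ T₁ := by
        intro x hx
        rcases Finset.mem_union.mp hx with h | h
        · exact Finset.mem_union_left _ h
        · refine Finset.mem_union_right _ ?_
          by_contra hxT₁
          have h0 := hT₁ x hxT₁
          rw [Matrix.mul_sub, Matrix.mul_one, sub_eq_zero] at h0
          exact (Finset.mem_filter.mp h).2 h0.symm
      calc T.card ≤ (S ∪ T₁).card := Finset.card_le_card hsub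
        _ ≤ S.card + T₁.card := Finset.card_union_le _ _
        _ ≤ 8 * r + 2 * r := Nat.add_le_add hS (hT₁card.trans hNY)
        _ = 10 * r := by ring
    -- `rank D ≤ #T`
    have hDrank : D.rank ≤ T.card := by
      have hDT : D = ∑ x ∈ T, P x * D := by
        conv_lhs => rw [hDsplit]
        rw [← Finset.sum_filter_add_sum_filter_not Finset.univ (fun x => x ∈ T)]
        have h0 : ∑ x ∈ Finset.univ.filter (fun x => x ∉ T), P x * D = 0 :=
          Finset.sum_eq_zero fun x hx => hgoodD x (Finset.mem_filter.mp hx).2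
        rw [h0, add_zero]
        congr 1
        ext x; simp
      rw [hDT]
      refine (rank_finsetSum_le T _).trans ?_
      calc ∑ x ∈ T, (P x * D).rank ≤ ∑ x ∈ T, 1 :=
            Finset.sum_le_sum fun x _ => (Matrix.rank_mul_le_left _ _).trans (hP1 x).le
        _ = T.card := by simp
    -- assemble
    have hfinal : (∑ y ∈ B, Q y) - ∑ y ∈ B, Q' y = D + (U * (∑ y ∈ B, α y) + (∑ y ∈ B, β y) * W) := by
      rw [hQB, hD]; abel
    rw [hfinal]
    calc (D + (U * (∑ y ∈ B, α y) + (∑ y ∈ B, β y) * W)).rank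
        ≤ D.rank + (U * (∑ y ∈ B, α y) + (∑ y ∈ B, β y) * W).rank := rank_add_le' _ _
      _ ≤ 10 * r + 2 * r := Nat.add_le_add (hDrank.trans hTcard) hN
      _ ≤ 384 * c := by omega

end Main

end Summit.PneNP.PneNP.Theorems.CnfIdealGenLengthRankDefectRepresentationsRankOneCells
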